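import Summits.QuantumFields.YangMills.Theorems.BalabanUVNodesN20FinalLevelRatioDomination

/-!
# N20 (NE7b), ITEM (a) OF THE FACE IN PRINT'S PER-REGION FORM: fibrewise domination letters on def-R's (0.3) fibre integral ENLARGE to bigger fibres and COMPOSE along a
# chain (Fubini on the finite Haar product), so the face's letter on the WHOLE removal fibre with the product factor clause follows from ONE-COMPONENT letters along a removal schedule

Cell `pub-ymgap`, YM-PLAN Track A (HUMAN RULING D-0062); seat `pub-ymgap-dag-n20-d` (R134 (a) N20 NE7b s3), gen 43 — director-ym №374 line (E), road [e] TOWER-FREE of record (№377).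
`--kind proof --supports stmt-QuantumFields-27366 --as helper` (K3⁸); COUNT-NEUTRAL helper ∕ NOT a discharge; THEOREMS ONLY (0 `def`).  [LF-II] = [Balaban1989LargeFieldII]; [IV] = [Balaban1989LargeFieldI].
Companions BY NAME: `…N20FinalLevelRatioDomination` (gen 39, p768103: `integral_le_mul_integral_of_fibreDom`, `sum_integral_le_mul_sum_image_of_fibreDom`), `B15.BasicStep.fibreIntegral`
(def-R's (0.3) restricted integral `∫dV⌈_{Z′}`), `B15.BasicStep.lmarginal_ofReal_le`, Mathlib `MeasureTheory.lmarginal_union ∕ lmarginal_le_of_subset ∕ lmarginal_mono`.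

WHY.  After gen 40–42 the N20 face of record on road [e] (✓p782644 `exists_margins_smallCoupling_relWeightBound_chronoGenealogies_ofRecord`) displays ONE estimate, item (a): per bad
history `s` a fibrewise letter on the WHOLE removal fibre, `∫⌈_{fib s}(χ·dr)(s) ≤ z s · ∫⌈_{fib s}(χ·dr)(rm s)` at every configuration, together with the factor clause
`z s ≤ Π_{Y ∈ φ σ s} e^{−credits(G Y)}·e^{+lifeCost(G Y)}` over the removed old components.  Print states its large-field bound PER REGION: [LF-II] (1.79) «holds for all large field
regions» (p. 384 l. 1–2) and «the inequality (1.79) holds for the T-operation connected with an arbitrary large field region … hence also an improved bound (1.89), with the additional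
term −κ₁d_k(X) in the exponential» (p. 387 l. 25–29); the product over SEPARATED components in (1.79) is the product of conditional integrations over DISJOINT sets of bond variables.
On def-R's objects that is Fubini on the finite product of Haar measures: `∫⌈_U = ∫⌈_{U ∖ fib} ∫⌈_{fib}` (Mathlib `lmarginal_union`).  Hence (§1) a letter on a component's OWN fibre
`fib ⊆ U`, uniform in the exterior configuration, IS a letter on `U` with the same factor, and letters along a chain `f₀ → f₁ → … → f_m` with fibres inside `U` compose to
`∫⌈_U f₀ ≤ (Π z_i)·∫⌈_U f_m`; so (§2) the face's pair «hDom on `fib s`» ∧ «factor clause» follows — with `z s := Π_i x(Y_i)` and the clause an EQUALITY — from ONE-COMPONENT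
relative letters «removing the old component `Y_i` from `u_i` costs at most `x(Y_i)` on `Y_i`'s fibre» along a removal schedule `s = u₀ → … → u_m = rm s`.  This is the reduction
the successor protocol (HOME `HANDOFF.md` (t72)(v)) had set aside as «off print's road»; the two locators above are why it is ON it.

WHAT IS PROVED (kernel; zero `sorry`; Fubini ∕ monotonicity of `lmarginal` and finite bookkeeping — every analytic input is a displayed hypothesis).
§1 `lmarginal_const_mul_fibre` (constants leave the Haar fibre marginal) · `lmarginal_ofReal_le_mul_of_fibreDom` ∕ `fibreIntegral_le_mul_of_lmarginal` (the real letter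
`∫⌈_s f ≤ z·∫⌈_s g` at a configuration ⟷ its `ℝ≥0∞` form, for densities bounded above — Bałaban's densities are continuous on a compact group) · ★ `fibreDom_mono_fibre` (a letter on
`fib ⊆ U` at every configuration is a letter on `U`) · `fibreDom_trans` · ★★ `fibreDom_chain` (`Fin`-indexed chain: letters `∫⌈_{fib i} f_i ≤ z_i·∫⌈_{fib i} f_{i+1}`, `fib i ⊆ U`,
`0 ≤ z_i` ⇒ `∫⌈_U f₀ ≤ (Π_i z_i)·∫⌈_U f_m` everywhere).
§2 ★★★ `fibreDom_schedule_of_oneComponentLetters`: for ANY family of densities `t : S → Density` bounded above and measurable, a bad set `B`, and per `s ∈ B` a removal SCHEDULE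
(`n s` links, states `chain s : Fin (n s + 1) → S` from `s`, components `comp s : Fin (n s) → X`, component fibres `fibY (comp s i) ⊆ fib s`, component factors `x ≥ 0`) with the
one-component letters along the links ⇒ EXACTLY the hDom clause of ✓p768103 §2–§4 ∕ ✓p773984 ∕ ✓p782644 on `fib s` with `rm s := chain s (Fin.last _)` and `z s := Π_i x (comp s i)`;
`prod_comp_eq_prod_image` (injective schedule ⇒ `Π_i x (comp s i) = Π_{Y ∈ image} x Y`, the face's factor clause with equality); ★★★ `sum_integral_le_mul_sum_image_of_oneComponentLetters`
(§2 ∘ ✓p768103 `sum_integral_le_mul_sum_image_of_fibreDom`: a bad class weighs at most the schedule-product multiplicity times its image classes).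

HONEST FRAMING.  [bookkeeping + Fubini].  The ONE-COMPONENT letter is print's (1.79)∕(1.89)-improved KIND read RELATIVELY on [IV] (0.3)'s fibre ratio — NOT PRINTED as a theorem
for `d = 4`, NOT proved here; its identification with print's `𝐓′_k(X)1` bound is the cell's open junction NC-NE7b-α (UNRULED); the schedule (which components, in which order, with
which fibres) is DATA (def-T's `SeqOfRecord` has no canonical deletion — def-R `PpSelOfRecord` docstring).  NOTHING of Bałaban's is asserted; NO weight of Bałaban's is bounded;
NE7 ∕ NE7b ∕ NE7c NOT PRINTED for `d = 4` ∕ NOT proved; K0⁷ ∕ K3⁸ untouched; N20 NOT discharged; counts UNMOVED (typed 28∕28 · discharged 8∕27); one finite four-torus programme at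
fixed `ε` — NOT ℝ⁴, NOT OS, NOT a mass gap, NOT the Clay problem.  No `def`, no `instance`, no `notation`, no `sorry`; no decl below carries a cite tag.
-/

noncomputable section

open MeasureTheory
open scoped BigOperators ENNReal
open Finset

namespace YMDAG.UVSplit

open Literature.MathematicalPhysics.QuantumFieldTheory.Balaban1983to89
open Literature.MathematicalPhysics.QuantumFieldTheory.Balaban1983to89.B15.BasicStep (fibreIntegral ofReal_comp_measurable lmarginal_ofReal_le)

/-! ## §1 Letters on def-R's fibre integral: `ℝ ⟷ ℝ≥0∞`, enlarging the fibre, composing along a chain -/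

section Fibre

variable {P : Params} {G : Type*} [GaugeGroup G] [MeasurableSpace G] [HaarData G] {j : ℕ}

/-- Finite constants leave the Haar fibre marginal: `∫⌈_s (c·F) = c·∫⌈_s F` (Mathlib `lintegral_const_mul'` under `lmarginal`). [bookkeeping] -/
theorem lmarginal_const_mul_fibre {iP : DecidableEq (PBond P j)} (s : Finset (PBond P j)) {c : ℝ≥0∞} (hc : c ≠ ∞) (F : GaugeField P j G → ℝ≥0∞) :
    (∫⋯∫⁻_s, (fun U => c * F U) ∂(fun _ : PBond P j => (HaarData.haar : Measure G))) =
      fun V => c * (∫⋯∫⁻_s, F ∂(fun _ : PBond P j => (HaarData.haar : Measure G))) V := by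
  funext V
  simp only [lmarginal]
  exact lintegral_const_mul' _ _ hc

/-- **THE REAL LETTER IN `ℝ≥0∞`**: if `f` is bounded above (so `∫⌈_s f` is finite), `0 ≤ z` and `∫⌈_s f ≤ z·∫⌈_s g` at the configuration `V` (def-R's real fibre integrals), then the
`ℝ≥0∞` marginals satisfy `∫⌈_s ofReal∘f ≤ ofReal z · ∫⌈_s ofReal∘g` at `V`. [bookkeeping] -/
theorem lmarginal_ofReal_le_mul_of_fibreDom {iP : DecidableEq (PBond P j)} (s : Finset (PBond P j)) {f g : Density P j G} {C z : ℝ}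
    (hfC : ∀ V, f V ≤ C) (hz : 0 ≤ z) (V : GaugeField P j G) (hDom : fibreIntegral s f V ≤ z * fibreIntegral s g V) :
    (∫⋯∫⁻_s, (fun U => ENNReal.ofReal (f U)) ∂(fun _ : PBond P j => (HaarData.haar : Measure G))) V ≤
      ENNReal.ofReal z * (∫⋯∫⁻_s, (fun U => ENNReal.ofReal (g U)) ∂(fun _ : PBond P j => (HaarData.haar : Measure G))) V := by
  set Lf := (∫⋯∫⁻_s, (fun U => ENNReal.ofReal (f U)) ∂(fun _ : PBond P j => (HaarData.haar : Measure G))) V with hLf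
  set Lg := (∫⋯∫⁻_s, (fun U => ENNReal.ofReal (g U)) ∂(fun _ : PBond P j => (HaarData.haar : Measure G))) V with hLg
  have hLf_top : Lf ≠ ∞ := ne_top_of_le_ne_top ENNReal.ofReal_ne_top (lmarginal_ofReal_le s hfC V)
  have h : Lf.toReal ≤ z * Lg.toReal := hDom
  calc Lf = ENNReal.ofReal Lf.toReal := (ENNReal.ofReal_toReal hLf_top).symm
    _ ≤ ENNReal.ofReal (z * Lg.toReal) := ENNReal.ofReal_le_ofReal h
    _ = ENNReal.ofReal z * ENNReal.ofReal Lg.toReal := ENNReal.ofReal_mul hz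
    _ ≤ ENNReal.ofReal z * Lg := by gcongr; exact ENNReal.ofReal_toReal_le

/-- **… AND BACK**: if `g` is bounded above, `0 ≤ z` and the `ℝ≥0∞` marginals satisfy `∫⌈_s ofReal∘f ≤ ofReal z · ∫⌈_s ofReal∘g` at `V`, then `∫⌈_s f ≤ z·∫⌈_s g` at `V` (real fibre
integrals). [bookkeeping] -/
theorem fibreIntegral_le_mul_of_lmarginal {iP : DecidableEq (PBond P j)} (s : Finset (PBond P j)) {f g : Density P j G} {C z : ℝ}
    (hgC : ∀ V, g V ≤ C) (hz : 0 ≤ z) (V : GaugeField P j G)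
    (hle : (∫⋯∫⁻_s, (fun U => ENNReal.ofReal (f U)) ∂(fun _ : PBond P j => (HaarData.haar : Measure G))) V ≤
      ENNReal.ofReal z * (∫⋯∫⁻_s, (fun U => ENNReal.ofReal (g U)) ∂(fun _ : PBond P j => (HaarData.haar : Measure G))) V) :
    fibreIntegral s f V ≤ z * fibreIntegral s g V := by
  have hLg_top : (∫⋯∫⁻_s, (fun U => ENNReal.ofReal (g U)) ∂(fun _ : PBond P j => (HaarData.haar : Measure G))) V ≠ ∞ :=
    ne_top_of_le_ne_top ENNReal.ofReal_ne_top (lmarginal_ofReal_le s hgC V)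
  have hR : ENNReal.ofReal z * (∫⋯∫⁻_s, (fun U => ENNReal.ofReal (g U)) ∂(fun _ : PBond P j => (HaarData.haar : Measure G))) V ≠ ∞ :=
    ENNReal.mul_ne_top ENNReal.ofReal_ne_top hLg_top
  have h := ENNReal.toReal_mono hR hle
  rw [ENNReal.toReal_mul, ENNReal.toReal_ofReal hz] at h
  simpa only [fibreIntegral] using h

/-- ★ **A LETTER ON A SUB-FIBRE IS A LETTER ON THE FIBRE** (Fubini on the finite Haar product: `∫⌈_U = ∫⌈_{U∖fib}∫⌈_{fib}`, Mathlib `lmarginal_le_of_subset`): for measurable densities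
`f, g` bounded above and `0 ≤ z`, if `∫⌈_{fib} f ≤ z·∫⌈_{fib} g` at EVERY configuration and `fib ⊆ U`, then `∫⌈_U f ≤ z·∫⌈_U g` at every configuration — a component's letter on
its OWN bond variables, uniform in the exterior, is a letter on any larger set of bond variables ([LF-II] p. 384 l. 1–2 «for all large field regions»). [bookkeeping] -/
theorem fibreDom_mono_fibre {iP : DecidableEq (PBond P j)} {fib U : Finset (PBond P j)} (hsub : fib ⊆ U) {f g : Density P j G}
    (hf : Measurable f) (hg : Measurable g) {Cf Cg z : ℝ} (hfC : ∀ V, f V ≤ Cf) (hgC : ∀ V, g V ≤ Cg) (hz : 0 ≤ z)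
    (hDom : ∀ V, fibreIntegral fib f V ≤ z * fibreIntegral fib g V) (V : GaugeField P j G) :
    fibreIntegral U f V ≤ z * fibreIntegral U g V := by
  have hF : Measurable fun U => ENNReal.ofReal (f U) := ofReal_comp_measurable hf
  have hG : Measurable fun U => ENNReal.ofReal (g U) := ofReal_comp_measurable hg
  have hzG : Measurable fun U => ENNReal.ofReal z * ENNReal.ofReal (g U) := hG.const_mul _
  -- the letter on `fib` in `ℝ≥0∞`, as an inequality of functions of the exterior configuration
  have hle : ∫⋯∫⁻_fib, (fun U => ENNReal.ofReal (f U)) ∂(fun _ : PBond P j => (HaarData.haar : Measure G)) ≤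
      ∫⋯∫⁻_fib, (fun U => ENNReal.ofReal z * ENNReal.ofReal (g U)) ∂(fun _ : PBond P j => (HaarData.haar : Measure G)) := by
    intro W
    rw [lmarginal_const_mul_fibre (iP := iP) fib (ENNReal.ofReal_ne_top (r := z)) (fun U => ENNReal.ofReal (g U))]
    exact lmarginal_ofReal_le_mul_of_fibreDom fib hfC hz W (hDom W)
  -- enlarge the fibre (Fubini) and come back to the real fibre integrals
  have hU := lmarginal_le_of_subset hsub hF hzG hle V
  have hc := congrFun (lmarginal_const_mul_fibre (iP := iP) U (ENNReal.ofReal_ne_top (r := z)) (fun U => ENNReal.ofReal (g U))) V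
  exact fibreIntegral_le_mul_of_lmarginal U hgC hz V (hU.trans hc.le)

/-- **LETTERS ON A COMMON FIBRE COMPOSE**: `∫⌈_s f ≤ z₁·∫⌈_s g` and `∫⌈_s g ≤ z₂·∫⌈_s h` at `V` with `0 ≤ z₁` give `∫⌈_s f ≤ (z₁ z₂)·∫⌈_s h` at `V`. [bookkeeping] -/
theorem fibreDom_trans {iP : DecidableEq (PBond P j)} (s : Finset (PBond P j)) {f g h : Density P j G} {z₁ z₂ : ℝ} (hz₁ : 0 ≤ z₁) (V : GaugeField P j G)
    (h₁ : fibreIntegral s f V ≤ z₁ * fibreIntegral s g V) (h₂ : fibreIntegral s g V ≤ z₂ * fibreIntegral s h V) :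
    fibreIntegral s f V ≤ z₁ * z₂ * fibreIntegral s h V :=
  h₁.trans (by rw [mul_assoc]; exact mul_le_mul_of_nonneg_left h₂ hz₁)

/-- ★★ **LETTERS ALONG A CHAIN COMPOSE ON THE BIG FIBRE**: a `Fin`-indexed chain of measurable densities `f 0, …, f m` bounded above, link fibres `fib i ⊆ U` and link factors `0 ≤ z i`;
if every link is a letter on its own fibre at every configuration — `∫⌈_{fib i} f i ≤ z i · ∫⌈_{fib i} f (i+1)` — then `∫⌈_U f 0 ≤ (Π_i z i) · ∫⌈_U f m` at every configuration
([LF-II] (1.79): the product over the components of the factors connected with them; here by induction on the links, `fibreDom_mono_fibre` + `fibreDom_trans`). [bookkeeping] -/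
theorem fibreDom_chain {iP : DecidableEq (PBond P j)} (U : Finset (PBond P j)) :
    ∀ (m : ℕ) (f : Fin (m + 1) → Density P j G) (fib : Fin m → Finset (PBond P j)) (C : Fin (m + 1) → ℝ) (z : Fin m → ℝ),
      (∀ i, fib i ⊆ U) → (∀ k, Measurable (f k)) → (∀ k V, f k V ≤ C k) → (∀ i, 0 ≤ z i) →
      (∀ (i : Fin m) (V : GaugeField P j G), fibreIntegral (fib i) (f i.castSucc) V ≤ z i * fibreIntegral (fib i) (f i.succ) V) →
      ∀ V : GaugeField P j G, fibreIntegral U (f 0) V ≤ (∏ i, z i) * fibreIntegral U (f (Fin.last m)) V := by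
  intro m
  induction m with
  | zero =>
      intro f fib C z _ _ _ _ _ V
      simp
  | succ m ih =>
      intro f fib C z hsub hm hC hz hDom V
      -- the first link, enlarged to `U`
      have h0 : fibreIntegral U (f 0) V ≤ z 0 * fibreIntegral U (f 1) V := by
        have h := fibreDom_mono_fibre (hsub 0) (hm (0 : Fin (m + 1)).castSucc) (hm (0 : Fin (m + 1)).succ) (hC _) (hC _) (hz 0) (hDom 0) V
        simpa only [Fin.castSucc_zero, Fin.succ_zero_eq_one] using h
      -- the remaining links (induction hypothesis on the shifted chain)
      have ht : fibreIntegral U (f 1) V ≤ (∏ i : Fin m, z i.succ) * fibreIntegral U (f (Fin.last (m + 1))) V := by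
        have h := ih (fun k => f k.succ) (fun i => fib i.succ) (fun k => C k.succ) (fun i => z i.succ)
          (fun i => hsub i.succ) (fun k => hm k.succ) (fun k => hC k.succ) (fun i => hz i.succ)
          (fun i W => by simpa only [Fin.succ_castSucc] using hDom i.succ W) V
        simpa only [Fin.succ_zero_eq_one, Fin.succ_last] using h
      have hprod : 0 ≤ ∏ i : Fin m, z i.succ := Finset.prod_nonneg fun i _ => hz i.succ
      rw [Fin.prod_univ_succ]
      calc fibreIntegral U (f 0) V ≤ z 0 * fibreIntegral U (f 1) V := h0
        _ ≤ z 0 * ((∏ i : Fin m, z i.succ) * fibreIntegral U (f (Fin.last (m + 1))) V) := mul_le_mul_of_nonneg_left ht (hz 0)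
        _ = z 0 * (∏ i : Fin m, z i.succ) * fibreIntegral U (f (Fin.last (m + 1))) V := by rw [mul_assoc]

end Fibre

/-! ## §2 The face's item (a) from one-component letters along a removal schedule -/

section Schedule

variable {P : Params} {G : Type*} [GaugeGroup G] [MeasurableSpace G] [HaarData G] {j : ℕ}
variable {S X : Type*}

/-- **An injective schedule's product is the product over its image**: `Π_i x (comp i) = Π_{Y ∈ univ.image comp} x Y` — the face's factor clause
`z s ≤ Π_{Y ∈ φ σ s} x Y` with EQUALITY when `φ σ s` is the set of scheduled components. [bookkeeping] -/
theorem prod_comp_eq_prod_image [DecidableEq X] {n : ℕ} (comp : Fin n → X) (hinj : Function.Injective comp) (x : X → ℝ) :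
    ∏ i, x (comp i) = ∏ Y ∈ (Finset.univ : Finset (Fin n)).image comp, x Y := by
  rw [Finset.prod_image fun i _ k _ h => hinj h]

/-- ★★★ **ITEM (a) OF THE N20 FACE FROM ONE-COMPONENT LETTERS.**  Any family of measurable densities `t : S → Density` bounded above (`t u ≤ C u`), a bad set `B`, fibre sets `fib`,
and for every `s ∈ B` a REMOVAL SCHEDULE: `n s` links, states `chain s : Fin (n s + 1) → S` starting at `s`, scheduled components `comp s : Fin (n s) → X` with component fibres
`fibY (comp s i) ⊆ fib s` and component factors `0 ≤ x Y`.  If every link is a ONE-COMPONENT letter on the component's own fibre at every configuration —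
`∫⌈_{fibY (comp s i)} t (chain s i) ≤ x (comp s i) · ∫⌈_{fibY (comp s i)} t (chain s (i+1))` ([LF-II] (1.79) «for the T-operation connected with an arbitrary large field region»
with the improved (1.89), read relatively on [IV] (0.3)'s fibre) — then the face's hDom clause holds on `fib s` with the removal map `rm s := chain s (last)` and the factor
`z s := Π_i x (comp s i)`: `∫⌈_{fib s} t s ≤ (Π_i x (comp s i)) · ∫⌈_{fib s} t (chain s (last))` at every configuration (`fibreDom_chain`). [bookkeeping] -/
theorem fibreDom_schedule_of_oneComponentLetters {iP : DecidableEq (PBond P j)} (t : S → Density P j G) (hm : ∀ u, Measurable (t u)) (C : S → ℝ)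
    (hC : ∀ u V, t u V ≤ C u) (B : Finset S) (fib : S → Finset (PBond P j)) (fibY : X → Finset (PBond P j)) (x : X → ℝ) (hx : ∀ Y, 0 ≤ x Y)
    (n : S → ℕ) (chain : (s : S) → Fin (n s + 1) → S) (comp : (s : S) → Fin (n s) → X)
    (h0 : ∀ s ∈ B, chain s 0 = s) (hsub : ∀ s ∈ B, ∀ i, fibY (comp s i) ⊆ fib s)
    (hlink : ∀ s ∈ B, ∀ (i : Fin (n s)) (V : GaugeField P j G),
      fibreIntegral (fibY (comp s i)) (t (chain s i.castSucc)) V ≤ x (comp s i) * fibreIntegral (fibY (comp s i)) (t (chain s i.succ)) V) :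
    ∀ s ∈ B, ∀ V : GaugeField P j G,
      fibreIntegral (fib s) (t s) V ≤ (∏ i, x (comp s i)) * fibreIntegral (fib s) (t (chain s (Fin.last (n s)))) V := by
  intro s hs V
  have h := fibreDom_chain (fib s) (n s) (fun k => t (chain s k)) (fun i => fibY (comp s i)) (fun k => C (chain s k)) (fun i => x (comp s i))
    (hsub s hs) (fun k => hm _) (fun k W => hC _ W) (fun i => hx _) (hlink s hs) V
  rwa [h0 s hs] at h

/-- ★★★ **… HENCE A BAD CLASS WEIGHS AT MOST THE SCHEDULE MULTIPLICITY TIMES ITS IMAGE CLASSES** (§2 ∘ ✓p768103 `sum_integral_le_mul_sum_image_of_fibreDom`): with non-negative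
integrable densities, the one-component letters along the schedules and the re-inserted products summing to at most `W` over each removal fibre —
`Σ_{s ∈ B : rm s = σ} Π_i x (comp s i) ≤ W` — give `Σ_{s∈B} ∫ t s ≤ W · Σ_{σ ∈ rm(B)} ∫ t σ`, `rm s := chain s (last)`. [bookkeeping] -/
theorem sum_integral_le_mul_sum_image_of_oneComponentLetters {iP : DecidableEq (PBond P j)} [DecidableEq S] (t : S → Density P j G) (hm : ∀ u, Measurable (t u))
    (h0t : ∀ u V, 0 ≤ t u V) (hint : ∀ u, Integrable (t u) (fieldMeasure P j G)) (C : S → ℝ) (hC : ∀ u V, t u V ≤ C u)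
    (B : Finset S) (fib : S → Finset (PBond P j)) (fibY : X → Finset (PBond P j)) (x : X → ℝ) (hx : ∀ Y, 0 ≤ x Y)
    (n : S → ℕ) (chain : (s : S) → Fin (n s + 1) → S) (comp : (s : S) → Fin (n s) → X)
    (h0 : ∀ s ∈ B, chain s 0 = s) (hsub : ∀ s ∈ B, ∀ i, fibY (comp s i) ⊆ fib s)
    (hlink : ∀ s ∈ B, ∀ (i : Fin (n s)) (V : GaugeField P j G),
      fibreIntegral (fibY (comp s i)) (t (chain s i.castSucc)) V ≤ x (comp s i) * fibreIntegral (fibY (comp s i)) (t (chain s i.succ)) V)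
    {W : ℝ} (hW : ∀ σ ∈ B.image (fun s => chain s (Fin.last (n s))), ∑ s ∈ B.filter (fun s => chain s (Fin.last (n s)) = σ), ∏ i, x (comp s i) ≤ W) :
    ∑ s ∈ B, ∫ V, t s V ∂fieldMeasure P j G ≤ W * ∑ σ ∈ B.image (fun s => chain s (Fin.last (n s))), ∫ V, t σ V ∂fieldMeasure P j G :=
  sum_integral_le_mul_sum_image_of_fibreDom t fib B (fun s => chain s (Fin.last (n s))) (fun s => ∏ i, x (comp s i)) hm h0t hint
    (fibreDom_schedule_of_oneComponentLetters t hm C hC B fib fibY x hx n chain comp h0 hsub hlink) hW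

end Schedule

end YMDAG.UVSplit

/-! ## Erratum (v1.1, append-only, prose only; ref-I READ-920 NIT 1 ∕ NIT 2)

LOCATORS.  The header's and `YMDAG.UVSplit.fibreDom_mono_fibre`'s quotation «for all large field regions (p. 384 l. 1–2)» is a paraphrase with a shifted locator.  The verbatim
sentence of [Balaban1989LargeFieldII] is p. 383, last two lines – p. 384 l. 1: «Notice that the above inequality holds for all large field regions, not only for the regions satisfying
the conditions (i), (ii).» (p. 384 l. 1–2 then reads «For the last regions we will prove that the expression on the right-hand side can be estimated by exp(−2p₀(g_k)). For general
regions we will prove the inductive statement below.»); the «arbitrary large field region» sentence is p. 387 l. 23–24 («the inequality (1.79) holds for the T-operation connected with an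
arbitrary large field region»), followed by l. 24–27 («The inequality (1.80) holds quite generally for such regions, hence also an improved bound (1.89), with the additional term
−κ₁d_k(X) in the exponential»).  CITES: the file rests on [Balaban1989LargeFieldII] (1.79) p. 383, (1.83) p. 385, (1.89) p. 387 and [Balaban1989LargeFieldI] (0.3) p. 176 as LOCATORS
only — nothing of either paper is asserted; every analytic input above is a displayed hypothesis.  No declaration is changed by this erratum. -/
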